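import Literature.Computability.AlgebraicComplexity.FlipGraphCyclicSymmetry
import HarnessLib

/-!
# The cyclic Brent equations (Moosbauer–Poole 2025, §6)

Topic `Literature/Computability/AlgebraicComplexity`; companion of `FlipGraphCyclicSymmetry.lean`
(the cyclic shift `cycleMap n` = MP's generator of `C₃`, `cycRep`, MP Def. 2 invariance
`isInvariantUnder_cyc_iff`) and `BrentEquations.lean` (Brent's equations). Source: J. Moosbauer,
M. Poole, *Flip Graphs with Symmetry and New Matrix Multiplication Schemes*, ISSAC 2025 =
arXiv:2502.04514 (MP), §6 "Lifting". Everything here is PROVED; there are no named facts.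

Printed (§6, verbatim): "We use a modification of the lifting procedure that preserves the cyclic
symmetry of the schemes. To this end we consider a cyclic version of the Brent equations. Let
`S = {((α^{(l)}_{i,j})) ⊗ ((β^{(l)}_{j,k})) ⊗ ((γ^{(l)}_{k,i})) | l = 1,…,k}` be a set of rank-one tensors
and let `T` be the rank-one tensors defined by the diagonal partition. Remember that the elements of
`T` are `C₃`-invariant. We have that `⋃{C₃·s : s ∈ S} ∪ T` is a `C₃`-invariant matrix multiplication
scheme if and only if the equations
`Σ_{l=1}^{k} α^{(l)}_{i₁,i₂} β^{(l)}_{j₁,j₂} γ^{(l)}_{k₁,k₂} + α^{(l)}_{j₁,j₂} β^{(l)}_{k₁,k₂} γ^{(l)}_{i₁,i₂}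
  + α^{(l)}_{k₁,k₂} β^{(l)}_{i₁,i₂} γ^{(l)}_{j₁,j₂} = (M_n − Σ_{t∈T} t)_{i₁,i₂,j₁,j₂,k₁,k₂}`
for `i₁,i₂,j₁,j₂,k₁,k₂ = 1,…,n` are satisfied."

What is typed (tree slots `(Z, X, Y)` of `matMulTensor K n n n`; the cyclic shift is
`cycleMap n : (ρT)(a,b,c) = T(cᵀ,aᵀ,b)`, `cycleMap_triad : ρ(z⊗x⊗y) = xᵀ⊗y⊗zᵀ`; multiset reading of
schemes, KM Def. 1):
* `cycOrbit n X = {X, ρX, ρ²X}` (the orbit `C₃·X` listed along the group — three entries, equal to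
  the orbit when it is full, which is the case MP use: "we only pass the rank-one tensors that have
  full orbits"), `cyclicUnion s T = ⋃_l C₃·s_l ∪ T` as a multiset;
* `cyclicBrent s (a,b,c) = Σ_l (s_l + ρ s_l + ρ² s_l)(a,b,c)` — the left-hand side of the cyclic Brent
  equation at the index `(a,b,c)`, and its coordinate form for rank-one representatives
  `cyclicBrent_triad` (the three cyclically shifted products of the printed display);
* **`moosbauerPoole2025_cyclicBrent_iff`**: `Σ (⋃_l C₃·s_l ∪ T) = M_n` iff the cyclic Brent
  equations `cyclicBrent s (a,b,c) = (M_n − Σ T)(a,b,c)` hold for all indices;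
* `cyclicUnion_map_cycleMap`: the multiset is `C₃`-invariant as soon as the elements of `T` are;
* **`moosbauerPoole2025_cyclicBrent_scheme`**: for non-zero rank-one representatives `s_l` and
  non-zero rank-one `C₃`-fixed `t ∈ T`, the equations give a `C₃`-invariant scheme of `⟨n,n,n⟩`
  (tree `Scheme`, `IsInvariantUnder (Set.range (cycRep n))`) with exactly these elements, and
  conversely (`cyclicBrent_of_scheme`).

## References

* J. Moosbauer, M. Poole, *Flip Graphs with Symmetry and New Matrix Multiplication Schemes*,
  Proc. ISSAC 2025, doi:10.1145/3747199.3747566, arXiv:2502.04514, §6 (Lifting: the cyclic Brent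
  equations). [MoosbauerPoole2025]
* R. P. Brent, *Algorithms for matrix multiplication*, Stanford CS report 157 (1970) (the Brent
  equations). [Brent1970]
-/

namespace Literature.Computability.AlgebraicComplexity

open scoped BigOperators
open Multiset

namespace FlipGraph

variable {K : Type*} [Field K] {n k : ℕ}

/-! ## §1 The orbit `C₃ · X` listed along the group -/

/-- **`C₃ · X = {X, ρX, ρ²X}`** listed along the group (a three-entry multiset).
[cite: MoosbauerPoole2025, §6 ("`⋃{C₃·s : s ∈ S}`")] -/
def cycOrbit (n : ℕ) (X : (Fin n × Fin n) → (Fin n × Fin n) → (Fin n × Fin n) → K) :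
    Multiset ((Fin n × Fin n) → (Fin n × Fin n) → (Fin n × Fin n) → K) :=
  X ::ₘ cycleMap n X ::ₘ {cycleMap n (cycleMap n X)}

omit [Field K] in
/-- It has three entries. [cite: MoosbauerPoole2025, §6] -/
theorem card_cycOrbit (X : (Fin n × Fin n) → (Fin n × Fin n) → (Fin n × Fin n) → K) :
    card (cycOrbit n X) = 3 := by
  simp [cycOrbit]

/-- Its sum is `X + ρX + ρ²X`. [cite: MoosbauerPoole2025, §6 (the three cyclic summands)] -/
theorem sum_cycOrbit (X : (Fin n × Fin n) → (Fin n × Fin n) → (Fin n × Fin n) → K) :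
    (cycOrbit n X).sum = X + cycleMap n X + cycleMap n (cycleMap n X) := by
  simp [cycOrbit, add_assoc]

omit [Field K] in
/-- `ρ³ = id` on tensors (restated from `cycleMap_iterate_three`). [cite: MoosbauerPoole2025, §2 (`C₃`)] -/
theorem cycleMap_cycleMap_cycleMap (X : (Fin n × Fin n) → (Fin n × Fin n) → (Fin n × Fin n) → K) :
    cycleMap n (cycleMap n (cycleMap n X)) = X :=
  cycleMap_iterate_three X

omit [Field K] in
/-- The listed orbit is invariant under the shift. [cite: MoosbauerPoole2025, §6 ("`C₃`-invariant")] -/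
theorem cycOrbit_map_cycleMap (X : (Fin n × Fin n) → (Fin n × Fin n) → (Fin n × Fin n) → K) :
    (cycOrbit n X).map (cycleMap n) = cycOrbit n X := by
  simp only [cycOrbit, Multiset.map_cons, Multiset.map_singleton, cycleMap_cycleMap_cycleMap]
  rw [← Multiset.singleton_add, ← Multiset.singleton_add, ← Multiset.singleton_add,
    ← Multiset.singleton_add]
  abel

/-! ## §2 `⋃_l C₃·s_l ∪ T` and the cyclic Brent equations -/

/-- **MP §6: the multiset `⋃{C₃·s : s ∈ S} ∪ T`** for representatives `s_l`, `l < k`, and the fixed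
part `T`. [cite: MoosbauerPoole2025, §6] -/
def cyclicUnion (s : Fin k → (Fin n × Fin n) → (Fin n × Fin n) → (Fin n × Fin n) → K)
    (T : Multiset ((Fin n × Fin n) → (Fin n × Fin n) → (Fin n × Fin n) → K)) :
    Multiset ((Fin n × Fin n) → (Fin n × Fin n) → (Fin n × Fin n) → K) :=
  ((Finset.univ : Finset (Fin k)).val.bind fun l => cycOrbit n (s l)) + T

/-- **The left-hand side of MP's cyclic Brent equation** at the index `(a, b, c)`:
`Σ_l (s_l + ρ s_l + ρ² s_l)(a,b,c)`. [cite: MoosbauerPoole2025, §6 (the displayed equations)] -/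
def cyclicBrent (s : Fin k → (Fin n × Fin n) → (Fin n × Fin n) → (Fin n × Fin n) → K)
    (a b c : Fin n × Fin n) : K :=
  ∑ l, (s l a b c + cycleMap n (s l) a b c + cycleMap n (cycleMap n (s l)) a b c)

/-- **The printed coordinate form** for rank-one representatives `s_l = z_l ⊗ x_l ⊗ y_l` (tree slots
`Z, X, Y`): the three summands at the index `(a, b, c)` are the product and its two cyclic shifts,
`s_l(a,b,c) + s_l(cᵀ,aᵀ,b) + s_l(bᵀ,c,aᵀ) = z(a)x(b)y(c) + z(bᵀ)x(c)y(aᵀ) + z(cᵀ)x(aᵀ)y(b)` (MP's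
`α_{i₁i₂}β_{j₁j₂}γ_{k₁k₂} + α_{j₁j₂}β_{k₁k₂}γ_{i₁i₂} + α_{k₁k₂}β_{i₁i₂}γ_{j₁j₂}` in their
`a_{ij}⊗b_{jk}⊗c_{ki}` indexing). [cite: MoosbauerPoole2025, §6 (the displayed equations)] -/
theorem cyclicBrent_triad (z x y : Fin k → Fin n × Fin n → K) (a b c : Fin n × Fin n) :
    cyclicBrent (fun l => triad (z l) (x l) (y l)) a b c =
      ∑ l, (z l a * x l b * y l c + z l b.swap * x l c * y l a.swap +
        z l c.swap * x l a.swap * y l b) := by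
  unfold cyclicBrent
  refine Finset.sum_congr rfl fun l _ => ?_
  simp only [cycleMap, triad_apply, Prod.swap_swap]
  ring

/-- The sum of `⋃_l C₃·s_l ∪ T`. [cite: MoosbauerPoole2025, §6] -/
theorem sum_cyclicUnion (s : Fin k → (Fin n × Fin n) → (Fin n × Fin n) → (Fin n × Fin n) → K)
    (T : Multiset ((Fin n × Fin n) → (Fin n × Fin n) → (Fin n × Fin n) → K)) :
    (cyclicUnion s T).sum =
      (∑ l, (s l + cycleMap n (s l) + cycleMap n (cycleMap n (s l)))) + T.sum := by
  rw [cyclicUnion, Multiset.sum_add, Multiset.sum_bind, Finset.sum_eq_multiset_sum]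
  congr 1
  exact congrArg Multiset.sum (Multiset.map_congr rfl fun l _ => sum_cycOrbit (s l))

/-- **MP §6 — "`⋃{C₃·s : s ∈ S} ∪ T` is a … matrix multiplication scheme if and only if the
[cyclic Brent] equations … are satisfied"**, at the level of the defining sum:
`Σ (⋃_l C₃·s_l ∪ T) = M_n ↔ ∀ (a,b,c), cyclicBrent s (a,b,c) = (M_n − Σ T)(a,b,c)`.
[cite: MoosbauerPoole2025, §6] -/
theorem moosbauerPoole2025_cyclicBrent_iff
    (s : Fin k → (Fin n × Fin n) → (Fin n × Fin n) → (Fin n × Fin n) → K)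
    (T : Multiset ((Fin n × Fin n) → (Fin n × Fin n) → (Fin n × Fin n) → K)) :
    (cyclicUnion s T).sum = matMulTensor K n n n ↔
      ∀ a b c, cyclicBrent s a b c = matMulTensor K n n n a b c - T.sum a b c := by
  rw [sum_cyclicUnion]
  constructor
  · intro h a b c
    have e := congrFun (congrFun (congrFun h a) b) c
    simp only [Pi.add_apply, Finset.sum_apply] at e
    rw [eq_sub_iff_add_eq, ← e]
    rfl
  · intro h
    funext a b c
    simp only [Pi.add_apply, Finset.sum_apply]
    have e := h a b c
    rw [eq_sub_iff_add_eq] at e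
    rw [← e]
    rfl

omit [Field K] in
/-- **"is `C₃`-invariant"**: the multiset `⋃_l C₃·s_l ∪ T` is mapped to itself by the shift as soon as
the elements of `T` are `C₃`-invariant ("Remember that the elements of `T` are `C₃`-invariant").
[cite: MoosbauerPoole2025, §6] -/
theorem cyclicUnion_map_cycleMap
    (s : Fin k → (Fin n × Fin n) → (Fin n × Fin n) → (Fin n × Fin n) → K)
    {T : Multiset ((Fin n × Fin n) → (Fin n × Fin n) → (Fin n × Fin n) → K)}
    (hT : ∀ t ∈ T, cycleMap n t = t) :
    (cyclicUnion s T).map (cycleMap n) = cyclicUnion s T := by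
  rw [cyclicUnion, Multiset.map_add, Multiset.map_bind]
  congr 1
  · exact Multiset.bind_congr fun l _ => cycOrbit_map_cycleMap (s l)
  · conv_rhs => rw [← Multiset.map_id T]
    exact Multiset.map_congr rfl fun t ht => hT t ht

/-! ## §3 As a `C₃`-invariant scheme (tree `Scheme`, MP Def. 2) -/

/-- Two schemes with the same elements are equal (bookkeeping). [folklore] -/
private theorem scheme_ext₆ {t : (Fin n × Fin n) → (Fin n × Fin n) → (Fin n × Fin n) → K}
    {x y : Scheme t} (h : x.elts = y.elts) : x = y := by
  cases x; cases y; cases h; rfl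

/-- The shift of a non-zero tensor is non-zero. [cite: MoosbauerPoole2025, §2 (the symmetries act linearly)] -/
theorem cycleMap_ne_zero {X : (Fin n × Fin n) → (Fin n × Fin n) → (Fin n × Fin n) → K}
    (hX : X ≠ 0) : cycleMap n X ≠ 0 := fun h =>
  hX (((Symmetry.cycleSq (K := K) n).toLinearEquiv.map_eq_zero_iff).mp h)

/-- **MP §6, scheme form:** if the representatives `s_l` are non-zero rank-one tensors, the elements
of `T` are non-zero rank-one `C₃`-invariant tensors, and the cyclic Brent equations hold, then
`⋃_l C₃·s_l ∪ T` is a `C₃`-invariant matrix multiplication scheme for `⟨n,n,n⟩`.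
[cite: MoosbauerPoole2025, §6] -/
theorem moosbauerPoole2025_cyclicBrent_scheme
    (s : Fin k → (Fin n × Fin n) → (Fin n × Fin n) → (Fin n × Fin n) → K)
    (hs0 : ∀ l, s l ≠ 0) (hs1 : ∀ l, ∃ z x y, s l = triad z x y)
    (T : Multiset ((Fin n × Fin n) → (Fin n × Fin n) → (Fin n × Fin n) → K))
    (hT0 : ∀ t ∈ T, t ≠ 0) (hT1 : ∀ t ∈ T, ∃ z x y, t = triad z x y)
    (hTfix : ∀ t ∈ T, cycleMap n t = t)
    (h : ∀ a b c, cyclicBrent s a b c = matMulTensor K n n n a b c - T.sum a b c) :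
    ∃ S : Scheme (matMulTensor K n n n),
      S.elts = cyclicUnion s T ∧ IsInvariantUnder (Set.range (cycRep (K := K) n)) S := by
  have hsum := (moosbauerPoole2025_cyclicBrent_iff s T).mpr h
  -- elements of the listed orbits are non-zero rank-one tensors
  have horb0 : ∀ l, ∀ Y ∈ cycOrbit n (s l), Y ≠ 0 := by
    intro l Y hY
    simp only [cycOrbit, Multiset.mem_cons, Multiset.mem_singleton] at hY
    rcases hY with rfl | rfl | rfl
    · exact hs0 l
    · exact cycleMap_ne_zero (hs0 l)
    · exact cycleMap_ne_zero (cycleMap_ne_zero (hs0 l))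
  have horb1 : ∀ l, ∀ Y ∈ cycOrbit n (s l), ∃ z x y, Y = triad z x y := by
    intro l Y hY
    obtain ⟨z, x, y, hl⟩ := hs1 l
    simp only [cycOrbit, Multiset.mem_cons, Multiset.mem_singleton] at hY
    rcases hY with rfl | rfl | rfl
    · exact ⟨z, x, y, hl⟩
    · rw [hl, cycleMap_triad]; exact ⟨_, _, _, rfl⟩
    · rw [hl, cycleMap_triad, cycleMap_triad]; exact ⟨_, _, _, rfl⟩
  refine ⟨⟨cyclicUnion s T, ?_, ?_, hsum⟩, rfl, ?_⟩
  · intro Y hY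
    rcases Multiset.mem_add.mp hY with hY | hY
    · obtain ⟨l, -, hl⟩ := Multiset.mem_bind.mp hY
      exact horb0 l Y hl
    · exact hT0 Y hY
  · intro Y hY
    rcases Multiset.mem_add.mp hY with hY | hY
    · obtain ⟨l, -, hl⟩ := Multiset.mem_bind.mp hY
      exact horb1 l Y hl
    · exact hT1 Y hY
  · rw [isInvariantUnder_cyc_iff]
    exact scheme_ext₆ (by
      rw [Scheme.map_elts]
      exact cyclicUnion_map_cycleMap s hTfix)

/-- **… and conversely:** a scheme of `⟨n,n,n⟩` whose elements are `⋃_l C₃·s_l ∪ T` satisfies the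
cyclic Brent equations. [cite: MoosbauerPoole2025, §6] -/
theorem cyclicBrent_of_scheme
    (s : Fin k → (Fin n × Fin n) → (Fin n × Fin n) → (Fin n × Fin n) → K)
    (T : Multiset ((Fin n × Fin n) → (Fin n × Fin n) → (Fin n × Fin n) → K))
    (S : Scheme (matMulTensor K n n n)) (hS : S.elts = cyclicUnion s T) (a b c : Fin n × Fin n) :
    cyclicBrent s a b c = matMulTensor K n n n a b c - T.sum a b c :=
  (moosbauerPoole2025_cyclicBrent_iff s T).mp (by rw [← hS]; exact S.sum_eq) a b c

end FlipGraph

end Literature.Computability.AlgebraicComplexity
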